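import Literature.MathematicalPhysics.QuantumFieldTheory.Balaban1983to89.B6Lemma21R0MultiLevelBox
import Literature.MathematicalPhysics.QuantumFieldTheory.Balaban1983to89.B6Prop23KLevelCensus

/-!
# `Balaban1983to89.B6Prop22KLevelCensusR0` — [B6] PROPOSITIONS 2.2 (2.67) AND 2.3 (2.87) AS THE CENSUS SENTENCES, AND
LEMMA 2.1 IN PARAMETER FORM, ON ONE GENUINE `k`-LEVEL FAMILY WITH PRINT'S DISTANCE (2.46) READ LITERALLY: the comparison
`d_R0 ≤ κ(d, L)·d_R2` between print's admissible-contour distance (reading R0, p29's `latC`) and the touching-block distance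
of p21's box geometry (reading R2), proved by COUNTING the bonds of p29's connectedness walks (`κ = (d+1)((d+1)(L−1)+1)`),
and the transport of p21's `prop22Printed_kLevelP` / `prop23Printed_kLevelP` to the R0 geometry `geoR0P` at the rates
`δ₀/κ`, `δ₁/κ` — the «k-level partial knit Lemma21Param ∧ Prop22 ∧ Prop23 on ONE family» of B6-CLOSURE §5 item 1
(no existing module is touched; no fact is minted; v1.1 = v1.0 + §4, v1.2 = v1.1 + §5, append-only)

FRAMING (verbatim cell line):
statement-level skeleton of published theorems with citation tags; proofs where landed; nothing here is a claim about the Yang–Mills mass gap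

Source under audit (cell pub-balaban / lit-balaban): T. Bałaban, *Propagators and renormalization transformations for
lattice gauge theories. II*, Commun. Math. Phys. **96** (1984) 223–250 [`Balaban1984PropagatorsII`, "B6"], p. 224 [PDF 2]
(2.1)–(2.4), p. 231 [PDF 9] (2.45)–(2.46), p. 233–234 [PDF 11–12] (2.54), (2.57), (2.59), Lemma 2.1, Prop. 2.2 (2.67),
p. 238 [PDF 16] Prop. 2.3 (2.86)–(2.87) (held text `paper:balaban1984-cmp96-propagators-rt-ii`, re-read this generation).
Unit `lit-balaban-p21` (Phase-2 proof seat p21 gen 14), HOME `run/shared/lean/pub/lit-balaban/`, free-target protocol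
G.5-34(d), B6 fold owner r03, referee ref-4; GAPS G-B6-22 (readings R0 ∕ R1 ∕ R2 of the admissible bonds; «pointwise
d_R2 ≤ d_R0 ≤ d_R1»).

## WHAT IS PRINTED (verbatim up to notation)

p. 231: «We consider a special class of contours Γ. They have the property that a part of Γ contained in B^j(Λ_j)
consists of bonds of the lattice Λ_j. Now we define d(y, y′) = inf_{Γ_{y,y′}} Σ_{j=0}^k (L^jη)^{−1}|Γ_{y,y′} ∩ B^j(Λ_j)|,
y, y′ ∈ 𝔅, (2.46) … Of course the infimum is attained at some contour Γ_{y,y′}.»  p. 233: «d(y, y₁) + d(y₁, y₂) + … +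
d(y_{n−1}, y′) ≥ d(y, y′). (2.54) This is of course the triangle inequality for our distance.»  p. 234: «**Proposition 2.2.**
If we have (2.1), (2.2) and M is sufficiently large, then the operator G′ = Δ′_a^{−1} (a = 1) satisfies the inequalities
|(G′λ)(x)|, |(∇G′λ)(x)|, |(G′∇*λ)(x)|, ‖ζ∇G′λ‖_α, ‖ζG′∇*λ‖_α, |(ΔG′λ)(x)| ≤ O(1)[(L^jη)², L^jη, L^jη, (L^jη)^{1−α}(‖ζ‖_α + |ζ|),
(L^jη)^{1−α}(‖ζ‖_α + |ζ|), 1]e^{−½δ₀d(y,y′)}|λ|, x ∈ B^j(y) or supp ζ ⊂ B^j(y), y ∈ Λ_j, supp λ ⊂ B^{j′}(y′), y′ ∈ Λ_{j′}.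
(2.67)».  p. 238: «**Proposition 2.3.** An inverse of the operator Q′G′²Q′* is given by the convergent expansion … (2.86)
and it satisfies the estimate |(Q′G′²Q′*)^{−1}(y, y′)| ≤ O(1)(L^jη)^{−4}(L^{j′}η)^{−d}e^{−½δ₁d(y,y′)} y, y′ ∈ 𝔅, y ∈ Λ_j,
y′ ∈ Λ_{j′}. (2.87)».

## WHAT THIS FILE CERTIFIES (kernel-checked; setting of `B6Lemma21R0MultiLevelBox`)

* §1 **QUANTITATIVE ADMISSIBLE CONTOURS IN p29's CUBE MODEL** (nested `Z`, the ℓ¹ collar `SepZd Z M₁ L N`, `N ≥ 1`, the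
  covering (2.4), `M₁ ≥ 1`, `L ≥ 2`; ambient dimension `dd`): a box of scale-`n` sites is joined by at most its
  ℓ¹-diameter many Λ_n-bonds (`dist_in_box_le`); the cube-sites of `x` and `x + e_μ` are joined by ≤ 1 bond when of the
  same scale (`dist_le_one_of_step_same`), by ≤ `dd(L−1) + 1` bonds into a coarser (`dist_le_of_step_up`: the slab walk
  of p29's `reachable_of_step_up` along the `−e_μ` face of the coarse cube, COUNTED) or a finer cube
  (`dist_le_of_step_down`: the coarse Λ_{n+1}-bond across the `+e_μ` face, then the face walk), hence in every case
  (`dist_le_of_unitStep`, scales differ by ≤ 1 by p29's `zone_le_succ_of_unitStep`);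
* §2 **ON THE BOX**: a unit lattice step inside the box costs ≤ `(d+1)(L−1) + 1` bonds of print's distance between the
  blocks of its end-points (`distR0_le_of_unitStep`); touching blocks (one bond of p21's `bond D`) are within
  `κ = (d+1)((d+1)(L−1) + 1)` (`distR0_le_of_near`, `distR0_le_of_touch`: the ≤ `d + 1` unit moves between sites at
  sup-distance ≤ 1, all inside the box); **`distR0_le_mul_distR2`: `d_R0(y, y′) ≤ κ·d_R2(y, y′)` for all blocks** (along a
  geodesic of `bond D`, p21's `connected`, the triangle inequality (2.54) of the R0 geometry); hence
  `e^{−½δ d_R2} ≤ e^{−½(δ/κ) d_R0}` (`exp_R2_le_exp_R0`);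
* §3 **THE CENSUS SENTENCES ON `geoR0P`** (the genuine `k`-level member in print's units with print's distance):
  `gpR0P`/`CinvR0P` (the (2.67) functionals and the (2.87) kernel of the member, re-typed), **`prop22Printed_kLevelR0P :
  B6.Prop22Printed (geoR0P) (gpR0P)`** (from `prop22Printed_kLevelP`: same `M₁`, `C`, `C_α ↦ max(C_α, 0)`, `δ₀ ↦ δ₀/κ`),
  **`prop23Printed_kLevelR0P : B6.Prop23Printed (d+1) (geoR0P) (CinvR0P)`** (`δ₁ ↦ δ₁/κ`), and the conjunction
  `knit_lemma21_prop22_prop23_kLevelR0P` = (`B6Lemma21Param` body, d-only c₁″, every `δ₀ > 0`) ∧ Prop22Printed ∧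
  Prop23Printed on ONE family — three conjuncts of `DagBinding.B6BlockParam` on a genuine `k`-level family;
* §4 (v1.1) **NON-VACUITY OF THE KNIT**: for every `k ≥ 2`, every threshold `M₁` and all `δ₀, α > 0` a member with `k`
  levels, `M ≥ M₁`, meeting `Hyp21_22` AND (2.59) `Cond259 (d+1) δ₀ α R M` (by `M` large at the member's `R ≥ 2L`), with
  blocks at both top levels (`knit_kLevelR0P_nonvacuous`, r03's `kLevelP_nonvacuous` witness) ∕ at three levels with (2.2)
  active (`knit_kLevelR0P_nonvacuous3`, `k ≥ 3`, gen 12's `kLevel_nonvacuous3`); `knit_kLevelR0P_with_nonvacuity` = the knit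
  ∧ its non-vacuity — the hypotheses of Lemma 2.1 ∕ Props. 2.2–2.3 on the R0 family are met beyond every threshold;
* §5 (v1.2) **THE CONVERSE COMPARISON `d_R2 ≤ d_R0`** (GAPS G-B6-22's pointwise remark, certified on the genuine family):
  `projB` (the block under a cube-site of the extension: clamp its corner into the box), `projB_iota`, `projB_adj` (one
  admissible bond of the extension projects to equal or touching blocks: p29's `touching_of_latStep` + the 1-Lipschitz clamp),
  **`distR2_le_distR0`**, `distR2_le_distR0_le_mul` (**`d_R2 ≤ d_R0 ≤ κ·d_R2`: the two readings of (2.46) are equivalent up to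
  `κ(d, L)` on the box family**), `exp_R0_le_exp_R2`, `dist_geoP_le_dist_geoR0P_le` (census member form).

## HONEST SCOPE

* The rates: `δ₀/κ(d, L)`, `δ₁/κ(d, L)` with `κ = (d+1)((d+1)(L−1)+1)` — print's «δ₀ depending on d and L only» is
  respected, the numerical value is not optimised (a coarse block touches a fine block in the middle of its face at R2-distance
  1 but at R0-distance up to `d(L−1)+1`: a factor of order `L` between the two readings' rates is in the nature of G-B6-22,
  the factor `d + 1` is our crude count of unit moves).  The thresholds `M₁` and the constants `C` are p21's.
* `C_α ↦ max(C_α, 0)`: the census sentence quantifies `∃ C_α : ℝ → ℝ` with no sign; the transport multiplies the bound by the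
  ratio of exponential factors, which needs a non-negative constant — `max(C_α, 0)` is again a legitimate witness.
* The R0 distance is that of the clamp extension of `B6Lemma21R0MultiLevelBox` (contours may leave the box through the
  extension; this only shortens them, and the comparison is an upper bound on `d_R0`); `Ω₁ = ℤ^{d+1}` (no level 0), Neumann
  box, lattice units ∕ print's units as in the census files; Lemma 2.4, Props. 2.5–2.7, Cor. 2.8 of `B6BlockParam` are NOT
  touched (no `BlockData` is built).
* Nothing is inferred from the manuscript: every step is kernel-checked; the quoted sentences locate the statements.
-/

namespace Literature.MathematicalPhysics.QuantumFieldTheory.Balaban1983to89.B6Prop22KLevelCensusR0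

open Literature.MathematicalPhysics.QuantumFieldTheory.Balaban1983to89
open Literature.MathematicalPhysics.QuantumFieldTheory.Balaban1983to89.B4ContourShift (supNorm abs_le_supNorm
  supNorm_nonneg exists_supNorm_eq)
open Literature.MathematicalPhysics.QuantumFieldTheory.Balaban1983to89.B4Reflection242 (boxDom mem_boxDom blk)
open Literature.MathematicalPhysics.QuantumFieldTheory.Balaban1983to89.B6MultiLevelBoxOperator (N0 Domains bigSide)
open Literature.MathematicalPhysics.QuantumFieldTheory.Balaban1983to89.B6Geom246MultiLevelBox (bset blkOf geom bond
  exists_blkOf_eq lev_eq_of_blkOf_eq blkOf_eq_iff_blk Touch bond_adj)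
open Literature.MathematicalPhysics.QuantumFieldTheory.Balaban1983to89.B15Ineq147LevelGap (cube CubeSite zoneC)
open Literature.MathematicalPhysics.QuantumFieldTheory.Balaban1983to89.B14DomainGeom (cubeIdx)
open Literature.MathematicalPhysics.QuantumFieldTheory.Balaban1983to89.B15LatticeCubeContours (latC latC_adj
  latC_adj_of_idx_succ site_eq_of_mem cornerC sideZ)
open Literature.MathematicalPhysics.QuantumFieldTheory.Balaban1983to89.B15TouchingCubeContours (Tiles mem_cube_iff_cubeIdx)
open Literature.MathematicalPhysics.QuantumFieldTheory.Balaban1983to89.B6Lemma21PrintedDomains (SepZd l1Dist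
  layer_of_near_sepZd zone_le_succ_of_unitStep sepZd_of_cond22 monotone_compl_of_antitone tiles_printedDomains
  latC_connected_of_sepZd)
open Literature.MathematicalPhysics.QuantumFieldTheory.Balaban1983to89.B6Lemma21R0MultiLevelBox
open Literature.MathematicalPhysics.QuantumFieldTheory.Balaban1983to89.B6Prop22KLevelCensus (KIdx)
open Literature.MathematicalPhysics.QuantumFieldTheory.Balaban1983to89.B6Prop22KLevelCensusEta (geoP gpP hqP hqP_nonneg
  nK nK_pos len_pos)
open Literature.MathematicalPhysics.QuantumFieldTheory.Balaban1983to89.B6Prop22KLevelCensusEtaUnif (prop22Printed_kLevelP)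
open Literature.MathematicalPhysics.QuantumFieldTheory.Balaban1983to89.B6Prop23KLevelCensus (CinvP prop23Printed_kLevelP)
open Literature.MathematicalPhysics.QuantumFieldTheory.Balaban1983to89.B6 (Geometry GpFamily SiteKernel Prop22Printed
  Prop23Printed pref4 Cond259)
open Literature.MathematicalPhysics.QuantumFieldTheory.Balaban1983to89.B6RandomWalk (Ineq260 Triangle254)
open Literature.MathematicalPhysics.QuantumFieldTheory.Balaban1983to89.B6Lemma21Repaired (Ineq261With)
open Literature.MathematicalPhysics.QuantumFieldTheory.Balaban1983to89.B6Lemma21TwoScale (c1TwoScale)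

noncomputable section

variable {d : ℕ}

/-! ## §1 Quantitative admissible contours in p29's cube model (reading R0 of (2.46)) -/

section General

variable {dd : ℕ} {M₁ L : ℕ} {Z : ℕ → Set (Fin dd → ℤ)}

/-- membership in a cube, unfolded. [folklore] -/
private theorem mem_cube' {n : ℕ} {c x : Fin dd → ℤ} :
    x ∈ cube M₁ L n c ↔ ∀ μ, ((M₁ * L ^ n : ℕ) : ℤ) * c μ ≤ x μ ∧ x μ < ((M₁ * L ^ n : ℕ) : ℤ) * (c μ + 1) := Iff.rfl

/-- From `S·a ≤ x < S·(b+1)` (S > 0): `a ≤ b`. [folklore] -/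
private theorem idx_le_of_bounds {S a b x : ℤ} (hS : 0 < S) (h1 : S * a ≤ x) (h2 : x < S * (b + 1)) : a ≤ b := by
  have h : S * a < S * (b + 1) := lt_of_le_of_lt h1 h2
  have := lt_of_mul_lt_mul_left h hS.le
  omega

/-- the ℓ¹ distance to a point moved in one coordinate. [folklore] -/
private theorem l1Dist_update (a : Fin dd → ℤ) (μ : Fin dd) (w : ℤ) :
    l1Dist a (Function.update a μ w) = |a μ - w| := by
  unfold l1Dist
  rw [Finset.sum_eq_single μ]
  · rw [Function.update_self]
  · intro ν _ hν
    rw [Function.update_of_ne hν, sub_self, abs_zero]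
  · intro h
    exact absurd (Finset.mem_univ μ) h

/-- **A BOX OF SCALE-`n` CUBE-SITES IS JOINED BY Λ_n-BONDS IN AT MOST ITS ℓ¹-DIAMETER MANY STEPS** (coordinate by
coordinate, one bond of Λ_n per unit move of the index): the quantitative form of
`B15LatticeCubeContours.reachable_in_box`. [cite: Balaban1984PropagatorsII, (2.46) p.231] -/
theorem dist_in_box_le (hconn : (latC M₁ L Z).Connected) (n : ℕ) (lo hi : Fin dd → ℤ)
    (hbox : ∀ c : Fin dd → ℤ, (∀ ν, lo ν ≤ c ν ∧ c ν ≤ hi ν) → cube M₁ L n c ⊆ Z (n + 1) \ Z n)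
    (u v : CubeSite M₁ L Z) (hun : u.1.1 = n) (hvn : v.1.1 = n)
    (hu : ∀ ν, lo ν ≤ u.1.2 ν ∧ u.1.2 ν ≤ hi ν) (hv : ∀ ν, lo ν ≤ v.1.2 ν ∧ v.1.2 ν ≤ hi ν) :
    ((latC M₁ L Z).dist u v : ℤ) ≤ ∑ ν, (hi ν - lo ν) := by
  classical
  -- the cube-site of an index of the box (junk `u` outside)
  let σ : (Fin dd → ℤ) → CubeSite M₁ L Z := fun c =>
    if hc : ∀ ν, lo ν ≤ c ν ∧ c ν ≤ hi ν then ⟨(n, c), hbox c hc⟩ else u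
  have hσ : ∀ c, (∀ ν, lo ν ≤ c ν ∧ c ν ≤ hi ν) → (σ c).1 = (n, c) := by
    intro c hc
    simp only [σ, dif_pos hc]
  have hσ_eq : ∀ (w : CubeSite M₁ L Z), w.1.1 = n → (∀ ν, lo ν ≤ w.1.2 ν ∧ w.1.2 ν ≤ hi ν) → σ w.1.2 = w := by
    intro w hwn hw
    apply Subtype.ext
    rw [hσ w.1.2 hw]
    exact Prod.ext hwn.symm rfl
  -- one bond: one unit step up in a coordinate
  have hstep : ∀ (c : Fin dd → ℤ) (μ : Fin dd), (∀ ν, lo ν ≤ c ν ∧ c ν ≤ hi ν) → c μ + 1 ≤ hi μ →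
      (latC M₁ L Z).dist (σ c) (σ (Function.update c μ (c μ + 1))) ≤ 1 := by
    intro c μ hc hμ
    have hc' : ∀ ν, lo ν ≤ Function.update c μ (c μ + 1) ν ∧ Function.update c μ (c μ + 1) ν ≤ hi ν := by
      intro ν
      by_cases hν : ν = μ
      · subst hν
        rw [Function.update_self]
        exact ⟨by linarith [(hc ν).1], hμ⟩
      · rw [Function.update_of_ne hν]
        exact hc ν
    have h1 := hσ c hc
    have h2 := hσ _ hc'
    have hadj : (latC M₁ L Z).Adj (σ c) (σ (Function.update c μ (c μ + 1))) := by
      refine latC_adj_of_idx_succ (μ := μ) ?_ ?_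
      · rw [show (σ (Function.update c μ (c μ + 1))).1.1 = n from congrArg Prod.fst h2,
          show (σ c).1.1 = n from congrArg Prod.fst h1]
      · rw [show (σ (Function.update c μ (c μ + 1))).1.2 = _ from congrArg Prod.snd h2,
          show (σ c).1.2 = c from congrArg Prod.snd h1]
    exact (SimpleGraph.dist_eq_one_iff_adj.2 hadj).le
  -- `m` unit steps up in one coordinate
  have hsteps : ∀ (c : Fin dd → ℤ) (μ : Fin dd) (m : ℕ), (∀ ν, lo ν ≤ c ν ∧ c ν ≤ hi ν) →
      c μ + m ≤ hi μ → (latC M₁ L Z).dist (σ c) (σ (Function.update c μ (c μ + m))) ≤ m := by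
    intro c μ m
    induction m with
    | zero =>
      intro _ _
      simp
    | succ m ih =>
      intro hc hm
      have hm' : c μ + (m : ℤ) ≤ hi μ := by push_cast at hm; linarith
      have h1 := ih hc hm'
      have hc₁ : ∀ ν, lo ν ≤ Function.update c μ (c μ + (m : ℤ)) ν ∧ Function.update c μ (c μ + (m : ℤ)) ν ≤ hi ν := by
        intro ν
        by_cases hν : ν = μ
        · subst hν
          rw [Function.update_self]
          exact ⟨by linarith [(hc ν).1], hm'⟩
        · rw [Function.update_of_ne hν]
          exact hc ν
      have h2 := hstep (Function.update c μ (c μ + (m : ℤ))) μ hc₁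
        (by rw [Function.update_self]; push_cast at hm; linarith)
      have e : Function.update (Function.update c μ (c μ + (m : ℤ))) μ
          (Function.update c μ (c μ + (m : ℤ)) μ + 1) = Function.update c μ (c μ + ((m + 1 : ℕ) : ℤ)) := by
        rw [Function.update_self, Function.update_idem]
        push_cast
        ring_nf
      rw [e] at h2
      calc (latC M₁ L Z).dist (σ c) (σ (Function.update c μ (c μ + ((m + 1 : ℕ) : ℤ))))
          ≤ (latC M₁ L Z).dist (σ c) (σ (Function.update c μ (c μ + (m : ℤ))))
            + (latC M₁ L Z).dist (σ (Function.update c μ (c μ + (m : ℤ))))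
              (σ (Function.update c μ (c μ + ((m + 1 : ℕ) : ℤ)))) := hconn.dist_triangle
        _ ≤ m + 1 := Nat.add_le_add h1 h2
  -- one coordinate to an arbitrary value of its range
  have hcoord : ∀ (c : Fin dd → ℤ) (μ : Fin dd) (w : ℤ), (∀ ν, lo ν ≤ c ν ∧ c ν ≤ hi ν) → lo μ ≤ w → w ≤ hi μ →
      ((latC M₁ L Z).dist (σ c) (σ (Function.update c μ w)) : ℤ) ≤ |c μ - w| := by
    intro c μ w hc hlo hhi
    rcases le_total (c μ) w with h | h
    · obtain ⟨m, hm⟩ := Int.le.dest h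
      have := hsteps c μ m hc (by rw [hm]; exact hhi)
      rw [hm] at this
      rw [abs_of_nonpos (by linarith), neg_sub, show w - c μ = (m : ℤ) by linarith]
      exact_mod_cast this
    · obtain ⟨m, hm⟩ := Int.le.dest h
      have hc' : ∀ ν, lo ν ≤ Function.update c μ w ν ∧ Function.update c μ w ν ≤ hi ν := by
        intro ν
        by_cases hν : ν = μ
        · subst hν
          rw [Function.update_self]
          exact ⟨hlo, hhi⟩
        · rw [Function.update_of_ne hν]
          exact hc ν
      have := hsteps (Function.update c μ w) μ m hc' (by rw [Function.update_self, hm]; exact (hc μ).2)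
      rw [Function.update_self, Function.update_idem, hm, Function.update_eq_self] at this
      rw [SimpleGraph.dist_comm, abs_of_nonneg (by linarith), show c μ - w = (m : ℤ) by linarith]
      exact_mod_cast this
  -- all coordinates, one at a time
  have hall : ∀ (T : Finset (Fin dd)) (c c' : Fin dd → ℤ), (∀ ν, lo ν ≤ c ν ∧ c ν ≤ hi ν) →
      (∀ ν, lo ν ≤ c' ν ∧ c' ν ≤ hi ν) → (∀ ν, ν ∉ T → c ν = c' ν) →
      ((latC M₁ L Z).dist (σ c) (σ c') : ℤ) ≤ ∑ ν ∈ T, (hi ν - lo ν) := by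
    intro T
    induction T using Finset.induction_on with
    | empty =>
      intro c c' _ _ h
      rw [show c = c' from funext fun ν => h ν (Finset.notMem_empty ν)]
      simp
    | @insert μ T hμT ih =>
      intro c c' hc hc' h
      have hc₁ : ∀ ν, lo ν ≤ Function.update c μ (c' μ) ν ∧ Function.update c μ (c' μ) ν ≤ hi ν := by
        intro ν
        by_cases hν : ν = μ
        · subst hν
          rw [Function.update_self]
          exact hc' ν
        · rw [Function.update_of_ne hν]
          exact hc ν
      have h1 := hcoord c μ (c' μ) hc (hc' μ).1 (hc' μ).2
      have h2 := ih (Function.update c μ (c' μ)) c' hc₁ hc' fun ν hν => by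
        by_cases hνμ : ν = μ
        · subst hνμ
          rw [Function.update_self]
        · rw [Function.update_of_ne hνμ]
          exact h ν (by simp [hνμ, hν])
      have h3 : |c μ - c' μ| ≤ hi μ - lo μ := by
        have := hc μ
        have := hc' μ
        rw [abs_le]
        constructor <;> linarith
      rw [Finset.sum_insert hμT]
      calc ((latC M₁ L Z).dist (σ c) (σ c') : ℤ)
          ≤ (latC M₁ L Z).dist (σ c) (σ (Function.update c μ (c' μ)))
            + (latC M₁ L Z).dist (σ (Function.update c μ (c' μ))) (σ c') := by
            exact_mod_cast hconn.dist_triangle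
        _ ≤ (hi μ - lo μ) + ∑ ν ∈ T, (hi ν - lo ν) := add_le_add (le_trans h1 h3) h2
  have := hall Finset.univ u.1.2 v.1.2 hu hv (fun ν hν => absurd (Finset.mem_univ ν) hν)
  rwa [hσ_eq u hun hu, hσ_eq v hvn hv] at this

/-- Face equations of two DIFFERENT cube-sites `s ∋ x` and `t ∋ x + e_μ` (as in p29's `B6Lemma21PrintedDomains`). [folklore] -/
private theorem face_eqs (hmono : Monotone Z) (hM₁ : 0 < M₁) (hL : 0 < L) {s t : CubeSite M₁ L Z} (hst : s ≠ t)
    {x : Fin dd → ℤ} {μ : Fin dd} (hx : x ∈ cube M₁ L s.1.1 s.1.2)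
    (hy : Function.update x μ (x μ + 1) ∈ cube M₁ L t.1.1 t.1.2) :
    x μ + 1 = ((M₁ * L ^ s.1.1 : ℕ) : ℤ) * (s.1.2 μ + 1) ∧ x μ + 1 = ((M₁ * L ^ t.1.1 : ℕ) : ℤ) * t.1.2 μ := by
  have hx' := (mem_cube' (M₁ := M₁)).mp hx
  have hy' := (mem_cube' (M₁ := M₁)).mp hy
  constructor
  · by_contra hne
    apply hst
    refine site_eq_of_mem hmono hM₁ hL (x := Function.update x μ (x μ + 1)) ?_ hy
    rw [mem_cube']
    intro ν
    by_cases hν : ν = μ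
    · subst hν
      rw [Function.update_self]
      have := hx' ν
      constructor <;> omega
    · rw [Function.update_of_ne hν]
      exact hx' ν
  · by_contra hne
    apply hst
    refine site_eq_of_mem hmono hM₁ hL hx (x := x) ?_
    rw [mem_cube']
    intro ν
    have h := hy' ν
    by_cases hν : ν = μ
    · subst hν
      rw [Function.update_self] at h
      constructor <;> omega
    · rw [Function.update_of_ne hν] at h
      exact h

/-- **SAME SCALE**: the cube of `x + e_μ` is the cube of `x` or the next one — at most ONE bond of Λ_n.
[cite: Balaban1984PropagatorsII, (2.46) p.231] -/
theorem dist_le_one_of_step_same (hmono : Monotone Z) (hM₁ : 0 < M₁) (hL : 0 < L) {s t : CubeSite M₁ L Z}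
    (hn : t.1.1 = s.1.1) {x : Fin dd → ℤ} {μ : Fin dd} (hx : x ∈ cube M₁ L s.1.1 s.1.2)
    (hy : Function.update x μ (x μ + 1) ∈ cube M₁ L t.1.1 t.1.2) : (latC M₁ L Z).dist s t ≤ 1 := by
  by_cases hst : s = t
  · subst hst
    simp
  obtain ⟨hF1, hF2⟩ := face_eqs hmono hM₁ hL hst hx hy
  have hx' := (mem_cube' (M₁ := M₁)).mp hx
  have hy' := (mem_cube' (M₁ := M₁)).mp hy
  rw [hn] at hF2 hy'
  have hS : (0 : ℤ) < ((M₁ * L ^ s.1.1 : ℕ) : ℤ) := by exact_mod_cast Nat.mul_pos hM₁ (Nat.pow_pos hL)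
  have hadj : (latC M₁ L Z).Adj s t := by
    refine latC_adj_of_idx_succ hn (μ := μ) (funext fun ν => ?_)
    by_cases hν : ν = μ
    · subst hν
      rw [Function.update_self]
      exact mul_left_cancel₀ hS.ne' (hF2.symm.trans hF1)
    · rw [Function.update_of_ne hν]
      have h1 := hx' ν
      have h2 := hy' ν
      rw [Function.update_of_ne hν] at h2
      have a := idx_le_of_bounds hS h1.1 h2.2
      have b := idx_le_of_bounds hS h2.1 h1.2
      omega
  exact (SimpleGraph.dist_eq_one_iff_adj.2 hadj).le

/-- the ℓ¹ diameter of an index box whose sides are `≤ L − 1` is `≤ dd·(L − 1)`. [folklore] -/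
private theorem sum_width_le {lo hi : Fin dd → ℤ} {W : ℤ} (h : ∀ ν, hi ν - lo ν ≤ W) :
    ∑ ν, (hi ν - lo ν) ≤ dd * W := by
  calc ∑ ν, (hi ν - lo ν) ≤ ∑ _ν : Fin dd, W := Finset.sum_le_sum fun ν _ => h ν
    _ = dd * W := by rw [Finset.sum_const, Finset.card_univ, Fintype.card_fin]; simp

set_option maxHeartbeats 400000 in
/-- **INTO A COARSER CUBE, QUANTITATIVELY** (`x` in a scale-`n` cube-site `s`, `x + e_μ` in a scale-`(n+1)` cube-site
`t`; nested `Z`, the ℓ¹ collar `SepZd Z M₁ L N` with `N ≥ 1`, the covering, `M₁ ≥ 1`, `L ≥ 2`): `s` is joined to `t` by at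
most `dd·(L − 1)` bonds of Λ_n along the `−e_μ` face of `t` (all cubes there are scale-`n` sites, p29's slab lemma
`layer_of_near_sepZd`) plus ONE Λ_n-bond into `t` at its corner — the walk of p29's `reachable_of_step_up`, counted.
[cite: Balaban1984PropagatorsII, (2.46) p.231] -/
theorem dist_le_of_step_up {N : ℕ} (hmono : Monotone Z) (hsep : SepZd Z M₁ L N) (hN : 1 ≤ N)
    (ht : Tiles M₁ L Z) (hM₁ : 0 < M₁) (hL : 2 ≤ L) {n : ℕ} {s t : CubeSite M₁ L Z} (hsn : s.1.1 = n)
    (htn : t.1.1 = n + 1) {x : Fin dd → ℤ} {μ : Fin dd} (hx : x ∈ cube M₁ L s.1.1 s.1.2)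
    (hy : Function.update x μ (x μ + 1) ∈ cube M₁ L t.1.1 t.1.2) :
    ((latC M₁ L Z).dist s t : ℤ) ≤ dd * ((L : ℤ) - 1) + 1 := by
  classical
  have hL0 : 0 < L := by omega
  have hconn := latC_connected_of_sepZd hmono hsep hN ht hM₁ hL
  have hst : s ≠ t := fun h => by rw [h, htn] at hsn; omega
  obtain ⟨hF1, hF2⟩ := face_eqs hmono hM₁ hL0 hst hx hy
  have hx' := (mem_cube' (M₁ := M₁)).mp hx
  have hy' := (mem_cube' (M₁ := M₁)).mp hy
  rw [hsn] at hF1 hx'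
  rw [htn] at hF2 hy'
  set S : ℤ := ((M₁ * L ^ n : ℕ) : ℤ) with hSdef
  set S' : ℤ := ((M₁ * L ^ (n + 1) : ℕ) : ℤ) with hS'def
  set c := s.1.2 with hcdef
  set c' := t.1.2 with hc'def
  set F := x μ + 1 with hFdef
  have hSpos : 0 < M₁ * L ^ n := Nat.mul_pos hM₁ (Nat.pow_pos hL0)
  have hS0 : (0 : ℤ) < S := by rw [hSdef]; exact_mod_cast hSpos
  have hS1 : (1 : ℤ) ≤ S := hS0
  have hSS : S' = S * (L : ℤ) := by rw [hS'def, hSdef]; push_cast; ring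
  have hL1 : (1 : ℤ) ≤ (L : ℤ) := by exact_mod_cast hL0
  have hSle : S ≤ S' := by rw [hSS]; nlinarith
  -- the slab of thickness S under the face x_μ = F of t
  let W : Set (Fin dd → ℤ) :=
    {z | F - S ≤ z μ ∧ z μ < F ∧ ∀ ν, ν ≠ μ → S' * c' ν ≤ z ν ∧ z ν < S' * (c' ν + 1)}
  have hWB : W ⊆ cube M₁ L (n + 1) (Function.update c' μ (c' μ - 1)) := by
    intro z hz
    obtain ⟨hz1, hz2, hz3⟩ := hz
    rw [mem_cube']
    intro ν
    by_cases hν : ν = μ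
    · subst hν
      rw [Function.update_self, sub_add_cancel, ← hS'def]
      constructor <;> nlinarith
    · rw [Function.update_of_ne hν, ← hS'def]
      exact hz3 ν hν
  have hnear : ∀ z ∈ W, ∃ b ∈ cube M₁ L t.1.1 t.1.2, l1Dist z b ≤ ((M₁ * L ^ n : ℕ) : ℤ) := by
    intro z hz
    obtain ⟨hz1, hz2, hz3⟩ := hz
    refine ⟨Function.update z μ F, ?_, ?_⟩
    · rw [htn, mem_cube']
      intro ν
      by_cases hν : ν = μ
      · subst hν
        rw [Function.update_self, ← hS'def]
        constructor <;> nlinarith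
      · rw [Function.update_of_ne hν, ← hS'def]
        exact hz3 ν hν
    · rw [l1Dist_update, ← hSdef, abs_le]
      constructor <;> omega
  have hxW : x ∈ W := by
    refine ⟨by omega, by omega, fun ν hν => ?_⟩
    have h := hy' ν
    rwa [Function.update_of_ne hν] at h
  have hlayer := layer_of_near_sepZd hmono hsep hN ht hM₁ hL t htn _ hWB hnear (s := s) hsn hx hxW
  -- the box of scale-n cubes under that face
  let lo : Fin dd → ℤ := Function.update (fun ν => (L : ℤ) * c' ν) μ (c μ)
  let hi : Fin dd → ℤ := Function.update (fun ν => (L : ℤ) * c' ν + L - 1) μ (c μ)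
  have hbox : ∀ e : Fin dd → ℤ, (∀ ν, lo ν ≤ e ν ∧ e ν ≤ hi ν) → cube M₁ L n e ⊆ Z (n + 1) \ Z n := by
    intro e he z hz
    apply hlayer z
    rw [mem_cube', ← hSdef] at hz
    have heμ : e μ = c μ := by
      have h := he μ
      simp only [lo, hi, Function.update_self] at h
      omega
    refine ⟨?_, ?_, fun ν hν => ?_⟩
    · have := (hz μ).1; rw [heμ] at this; nlinarith
    · have := (hz μ).2; rw [heμ] at this; nlinarith
    · have h := he ν
      simp only [lo, hi, Function.update_of_ne hν] at h
      have h1 := (hz ν).1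
      have h2 := (hz ν).2
      rw [hSS]
      constructor <;> nlinarith
  have hsbox : ∀ ν, lo ν ≤ c ν ∧ c ν ≤ hi ν := by
    intro ν
    by_cases hν : ν = μ
    · subst hν
      simp only [lo, hi, Function.update_self]
      omega
    · simp only [lo, hi, Function.update_of_ne hν]
      have h1 := hx' ν
      have h2 := hy' ν
      rw [Function.update_of_ne hν, hSS] at h2
      have ea : S * ((L : ℤ) * c' ν) = S * (L : ℤ) * c' ν := by ring
      have eb : S * ((L : ℤ) * c' ν + L - 1 + 1) = S * (L : ℤ) * (c' ν + 1) := by ring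
      have a : (L : ℤ) * c' ν ≤ c ν := idx_le_of_bounds hS0 (by rw [ea]; exact h2.1) h1.2
      have b : c ν ≤ (L : ℤ) * c' ν + L - 1 := idx_le_of_bounds hS0 h1.1 (by rw [eb]; exact h2.2)
      exact ⟨a, b⟩
  -- the scale-n cube at the corner of t
  let e₀ : Fin dd → ℤ := Function.update (fun ν => (L : ℤ) * c' ν) μ (c μ)
  have he₀ : ∀ ν, lo ν ≤ e₀ ν ∧ e₀ ν ≤ hi ν := by
    intro ν
    by_cases hν : ν = μ
    · subst hν
      simp only [lo, hi, e₀, Function.update_self]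
      omega
    · simp only [lo, hi, e₀, Function.update_of_ne hν]
      constructor <;> nlinarith
  let k₀ : CubeSite M₁ L Z := ⟨(n, e₀), hbox e₀ he₀⟩
  have h1 : ((latC M₁ L Z).dist s k₀ : ℤ) ≤ ∑ ν, (hi ν - lo ν) :=
    dist_in_box_le hconn n lo hi hbox s k₀ hsn rfl hsbox he₀
  have hwidth : ∀ ν, hi ν - lo ν ≤ (L : ℤ) - 1 := by
    intro ν
    by_cases hν : ν = μ
    · subst hν
      simp only [lo, hi, Function.update_self]
      linarith
    · simp only [lo, hi, Function.update_of_ne hν]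
      linarith
  have h1' : ((latC M₁ L Z).dist s k₀ : ℤ) ≤ dd * ((L : ℤ) - 1) := le_trans h1 (sum_width_le hwidth)
  have h2 : (latC M₁ L Z).Adj k₀ t := by
    refine latC_adj.mpr ⟨fun h => ?_, Or.inl ⟨μ, funext fun ν => ?_⟩⟩
    · have h' : k₀.1.1 = t.1.1 := congrArg (fun w : CubeSite M₁ L Z => w.1.1) h
      change n = t.1.1 at h'
      omega
    · rw [Pi.add_apply]
      change ((M₁ * L ^ t.1.1 : ℕ) : ℤ) * t.1.2 ν = ((M₁ * L ^ n : ℕ) : ℤ) * e₀ ν + (Pi.single μ (sideZ M₁ L n) : Fin dd → ℤ) ν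
      rw [htn, ← hS'def, ← hSdef, show sideZ M₁ L n = S from rfl]
      by_cases hν : ν = μ
      · subst hν
        simp only [e₀, Function.update_self, Pi.single_eq_same]
        linear_combination hF1 - hF2
      · simp only [e₀, Function.update_of_ne hν, Pi.single_eq_of_ne hν, add_zero]
        rw [hSS]
        ring
  have h2' : ((latC M₁ L Z).dist k₀ t : ℤ) ≤ 1 := by
    exact_mod_cast (SimpleGraph.dist_eq_one_iff_adj.2 h2).le
  calc ((latC M₁ L Z).dist s t : ℤ) ≤ (latC M₁ L Z).dist s k₀ + (latC M₁ L Z).dist k₀ t := by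
        exact_mod_cast hconn.dist_triangle
    _ ≤ dd * ((L : ℤ) - 1) + 1 := add_le_add h1' h2'

set_option maxHeartbeats 400000 in
/-- **INTO A FINER CUBE, QUANTITATIVELY** (`x` in a scale-`(n+1)` cube-site `s`, `x + e_μ` in a scale-`n` cube-site `t`):
ONE Λ_{n+1}-bond from the corner of `s` across its `+e_μ` face (the coarse bond of reading R0) reaches the scale-`n` cube at
the corner, which is joined to `t` by at most `dd·(L − 1)` Λ_n-bonds along the face — the walk of p29's
`reachable_of_step_down`, counted. [cite: Balaban1984PropagatorsII, (2.46) p.231] -/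
theorem dist_le_of_step_down {N : ℕ} (hmono : Monotone Z) (hsep : SepZd Z M₁ L N) (hN : 1 ≤ N)
    (ht : Tiles M₁ L Z) (hM₁ : 0 < M₁) (hL : 2 ≤ L) {n : ℕ} {s t : CubeSite M₁ L Z} (hsn : s.1.1 = n + 1)
    (htn : t.1.1 = n) {x : Fin dd → ℤ} {μ : Fin dd} (hx : x ∈ cube M₁ L s.1.1 s.1.2)
    (hy : Function.update x μ (x μ + 1) ∈ cube M₁ L t.1.1 t.1.2) :
    ((latC M₁ L Z).dist s t : ℤ) ≤ dd * ((L : ℤ) - 1) + 1 := by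
  classical
  have hL0 : 0 < L := by omega
  have hconn := latC_connected_of_sepZd hmono hsep hN ht hM₁ hL
  have hst : s ≠ t := fun h => by rw [h, htn] at hsn; omega
  obtain ⟨hF1, hF2⟩ := face_eqs hmono hM₁ hL0 hst hx hy
  have hx' := (mem_cube' (M₁ := M₁)).mp hx
  have hy' := (mem_cube' (M₁ := M₁)).mp hy
  rw [hsn] at hF1 hx'
  rw [htn] at hF2 hy'
  set S : ℤ := ((M₁ * L ^ n : ℕ) : ℤ) with hSdef
  set S' : ℤ := ((M₁ * L ^ (n + 1) : ℕ) : ℤ) with hS'def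
  set c := s.1.2 with hcdef
  set c' := t.1.2 with hc'def
  set F := x μ + 1 with hFdef
  have hSpos : 0 < M₁ * L ^ n := Nat.mul_pos hM₁ (Nat.pow_pos hL0)
  have hS0 : (0 : ℤ) < S := by rw [hSdef]; exact_mod_cast hSpos
  have hS1 : (1 : ℤ) ≤ S := hS0
  have hSS : S' = S * (L : ℤ) := by rw [hS'def, hSdef]; push_cast; ring
  have hL1 : (1 : ℤ) ≤ (L : ℤ) := by exact_mod_cast hL0
  have hSle : S ≤ S' := by rw [hSS]; nlinarith
  -- the slab of thickness S above the face x_μ = F of s (it contains x + e_μ ∈ t)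
  let W : Set (Fin dd → ℤ) :=
    {z | F ≤ z μ ∧ z μ < F + S ∧ ∀ ν, ν ≠ μ → S' * c ν ≤ z ν ∧ z ν < S' * (c ν + 1)}
  have hWB : W ⊆ cube M₁ L (n + 1) (Function.update c μ (c μ + 1)) := by
    intro z hz
    obtain ⟨hz1, hz2, hz3⟩ := hz
    rw [mem_cube']
    intro ν
    by_cases hν : ν = μ
    · subst hν
      rw [Function.update_self, ← hS'def]
      constructor <;> nlinarith
    · rw [Function.update_of_ne hν, ← hS'def]
      exact hz3 ν hν
  have hnear : ∀ z ∈ W, ∃ b ∈ cube M₁ L s.1.1 s.1.2, l1Dist z b ≤ ((M₁ * L ^ n : ℕ) : ℤ) := by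
    intro z hz
    obtain ⟨hz1, hz2, hz3⟩ := hz
    refine ⟨Function.update z μ (F - 1), ?_, ?_⟩
    · rw [hsn, mem_cube']
      intro ν
      by_cases hν : ν = μ
      · subst hν
        rw [Function.update_self, ← hS'def]
        constructor <;> nlinarith
      · rw [Function.update_of_ne hν, ← hS'def]
        exact hz3 ν hν
    · rw [l1Dist_update, ← hSdef, abs_le]
      constructor <;> omega
  have hyW : Function.update x μ (x μ + 1) ∈ W := by
    refine ⟨by rw [Function.update_self], by rw [Function.update_self]; omega, fun ν hν => ?_⟩
    rw [Function.update_of_ne hν]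
    exact hx' ν
  have hlayer := layer_of_near_sepZd hmono hsep hN ht hM₁ hL s hsn _ hWB hnear (s := t) htn hy hyW
  -- the box of scale-n cubes above that face
  let lo : Fin dd → ℤ := Function.update (fun ν => (L : ℤ) * c ν) μ (c' μ)
  let hi : Fin dd → ℤ := Function.update (fun ν => (L : ℤ) * c ν + L - 1) μ (c' μ)
  have hc'μ : S * c' μ = F := hF2.symm
  have hbox : ∀ e : Fin dd → ℤ, (∀ ν, lo ν ≤ e ν ∧ e ν ≤ hi ν) → cube M₁ L n e ⊆ Z (n + 1) \ Z n := by
    intro e he z hz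
    apply hlayer z
    rw [mem_cube', ← hSdef] at hz
    have heμ : e μ = c' μ := by
      have h := he μ
      simp only [lo, hi, Function.update_self] at h
      omega
    refine ⟨?_, ?_, fun ν hν => ?_⟩
    · have := (hz μ).1; rw [heμ, hc'μ] at this; exact this
    · have := (hz μ).2; rw [heμ] at this; nlinarith
    · have h := he ν
      simp only [lo, hi, Function.update_of_ne hν] at h
      have h1 := (hz ν).1
      have h2 := (hz ν).2
      rw [hSS]
      constructor <;> nlinarith
  have htbox : ∀ ν, lo ν ≤ c' ν ∧ c' ν ≤ hi ν := by
    intro ν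
    by_cases hν : ν = μ
    · subst hν
      simp only [lo, hi, Function.update_self]
      omega
    · simp only [lo, hi, Function.update_of_ne hν]
      have h1 := hx' ν
      have h2 := hy' ν
      rw [Function.update_of_ne hν] at h2
      rw [hSS] at h1
      have ea : S * ((L : ℤ) * c ν) = S * (L : ℤ) * c ν := by ring
      have eb : S * ((L : ℤ) * c ν + L - 1 + 1) = S * (L : ℤ) * (c ν + 1) := by ring
      have a : (L : ℤ) * c ν ≤ c' ν := idx_le_of_bounds hS0 (by rw [ea]; exact h1.1) h2.2
      have b : c' ν ≤ (L : ℤ) * c ν + L - 1 := idx_le_of_bounds hS0 h2.1 (by rw [eb]; exact h1.2)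
      exact ⟨a, b⟩
  -- the scale-n cube at the far corner of the +e_μ face of s
  let e₀ : Fin dd → ℤ := Function.update (fun ν => (L : ℤ) * c ν) μ (c' μ)
  have he₀ : ∀ ν, lo ν ≤ e₀ ν ∧ e₀ ν ≤ hi ν := by
    intro ν
    by_cases hν : ν = μ
    · subst hν
      simp only [lo, hi, e₀, Function.update_self]
      omega
    · simp only [lo, hi, e₀, Function.update_of_ne hν]
      constructor <;> nlinarith
  let k₀ : CubeSite M₁ L Z := ⟨(n, e₀), hbox e₀ he₀⟩
  have h1 : (latC M₁ L Z).Adj s k₀ := by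
    refine latC_adj.mpr ⟨fun h => ?_, Or.inl ⟨μ, funext fun ν => ?_⟩⟩
    · have h' : s.1.1 = k₀.1.1 := congrArg (fun w : CubeSite M₁ L Z => w.1.1) h
      change s.1.1 = n at h'
      omega
    · rw [Pi.add_apply]
      change ((M₁ * L ^ n : ℕ) : ℤ) * e₀ ν = ((M₁ * L ^ s.1.1 : ℕ) : ℤ) * s.1.2 ν
        + (Pi.single μ (sideZ M₁ L s.1.1) : Fin dd → ℤ) ν
      rw [hsn, ← hS'def, ← hSdef, show sideZ M₁ L (n + 1) = S' from rfl]
      by_cases hν : ν = μ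
      · subst hν
        simp only [e₀, Function.update_self, Pi.single_eq_same]
        linear_combination hF1 - hF2
      · simp only [e₀, Function.update_of_ne hν, Pi.single_eq_of_ne hν, add_zero]
        rw [hSS]
        ring
  have h1' : ((latC M₁ L Z).dist s k₀ : ℤ) ≤ 1 := by
    exact_mod_cast (SimpleGraph.dist_eq_one_iff_adj.2 h1).le
  have h2 : ((latC M₁ L Z).dist k₀ t : ℤ) ≤ ∑ ν, (hi ν - lo ν) :=
    dist_in_box_le hconn n lo hi hbox k₀ t rfl htn he₀ htbox
  have hwidth : ∀ ν, hi ν - lo ν ≤ (L : ℤ) - 1 := by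
    intro ν
    by_cases hν : ν = μ
    · subst hν
      simp only [lo, hi, Function.update_self]
      linarith
    · simp only [lo, hi, Function.update_of_ne hν]
      linarith
  have h2' : ((latC M₁ L Z).dist k₀ t : ℤ) ≤ dd * ((L : ℤ) - 1) := le_trans h2 (sum_width_le hwidth)
  calc ((latC M₁ L Z).dist s t : ℤ) ≤ (latC M₁ L Z).dist s k₀ + (latC M₁ L Z).dist k₀ t := by
        exact_mod_cast hconn.dist_triangle
    _ ≤ dd * ((L : ℤ) - 1) + 1 := by linarith

/-- **ONE UNIT STEP OF THE LATTICE COSTS AT MOST `dd·(L − 1) + 1` ADMISSIBLE BONDS**: the cube-sites of `x` and `x + e_μ`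
(any scales — they differ by at most one, `zone_le_succ_of_unitStep`) are within that distance in p29's `latC`.
[cite: Balaban1984PropagatorsII, (2.46) p.231, (2.2) p.224] -/
theorem dist_le_of_unitStep {N : ℕ} (hmono : Monotone Z) (hsep : SepZd Z M₁ L N) (hN : 1 ≤ N)
    (ht : Tiles M₁ L Z) (hM₁ : 0 < M₁) (hL : 2 ≤ L) {s t : CubeSite M₁ L Z} {x : Fin dd → ℤ} {μ : Fin dd}
    (hx : x ∈ cube M₁ L s.1.1 s.1.2) (hy : Function.update x μ (x μ + 1) ∈ cube M₁ L t.1.1 t.1.2) :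
    ((latC M₁ L Z).dist s t : ℤ) ≤ dd * ((L : ℤ) - 1) + 1 := by
  obtain ⟨h1, h2⟩ := zone_le_succ_of_unitStep hmono hsep hN hM₁ (by omega) hx hy
  have hL1 : (0 : ℤ) ≤ dd * ((L : ℤ) - 1) := by
    have : (1 : ℤ) ≤ L := by exact_mod_cast (show 1 ≤ L by omega)
    positivity
  rcases (show t.1.1 = s.1.1 ∨ t.1.1 = s.1.1 + 1 ∨ s.1.1 = t.1.1 + 1 by omega) with h | h | h
  · have := dist_le_one_of_step_same hmono hM₁ (by omega) h hx hy
    calc ((latC M₁ L Z).dist s t : ℤ) ≤ 1 := by exact_mod_cast this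
      _ ≤ dd * ((L : ℤ) - 1) + 1 := by linarith
  · exact dist_le_of_step_up hmono hsep hN ht hM₁ hL rfl h hx hy
  · exact dist_le_of_step_down hmono hsep hN ht hM₁ hL h rfl hx hy

end General

/-! ## §2 On the box: print's distance (R0) against the touching-block distance (R2) -/

section Compare

variable {ℓ Mh k R : ℕ} {P : Fin (d + 1) → ℕ} (D : Domains d ℓ Mh k P R)

/-- the comparison constant `κ(d, L) = (d+1)·((d+1)(L−1) + 1)`: each of the `≤ d + 1` unit moves between touching
blocks costs at most `(d+1)(L−1) + 1` admissible bonds. [cite: Balaban1984PropagatorsII, (2.46) p.231, dictionary] -/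
def kap (d ℓ : ℕ) : ℝ := ((d : ℝ) + 1) * (((d : ℝ) + 1) * ℓ + 1)

/-- `κ > 0`. [cite: Balaban1984PropagatorsII, (2.46) p.231, dictionary] -/
theorem kap_pos (d ℓ : ℕ) : 0 < kap d ℓ := by unfold kap; positivity

/-- `1 ≤ κ`. [cite: Balaban1984PropagatorsII, (2.46) p.231, dictionary] -/
theorem one_le_kap (d ℓ : ℕ) : 1 ≤ kap d ℓ := by
  unfold kap
  have h1 : (1 : ℝ) ≤ (d : ℝ) + 1 := by linarith [Nat.cast_nonneg (α := ℝ) d]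
  have h2 : (1 : ℝ) ≤ ((d : ℝ) + 1) * ℓ + 1 := by
    have : (0 : ℝ) ≤ ((d : ℝ) + 1) * ℓ := by positivity
    linarith
  nlinarith

/-- a box site lies in the `Lʲ`-cube of its block (the cube of the embedded cube-site `iota (blkOf x)`).
[cite: Balaban1984PropagatorsII, (2.45) p.231, dictionary] -/
theorem mem_cube_blkOf (x : ↥(boxDom (N0 ℓ Mh k P))) :
    x.1 ∈ cube 1 (ℓ + 1) (iota D (blkOf D x)).1.1 (iota D (blkOf D x)).1.2 := by
  change x.1 ∈ cube 1 (ℓ + 1) (D.lev x.1) (blk ((ℓ + 1) ^ D.lev x.1) x.1)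
  rw [mem_cube_iff_cubeIdx (Nat.mul_pos Nat.one_pos (Nat.pow_pos (by omega)))]
  funext μ
  simp only [blk, cubeIdx]
  push_cast
  ring_nf

/-- **A UNIT LATTICE STEP INSIDE THE BOX COSTS AT MOST `(d+1)(L−1) + 1` ADMISSIBLE BONDS** between the blocks of its
end-points (print's distance, R0). [cite: Balaban1984PropagatorsII, (2.46) p.231, (2.2) p.224] -/
theorem distR0_le_of_unitStep (hℓ : 1 ≤ ℓ) (hMh : 1 ≤ Mh) (hR : 1 ≤ R) (hP : ∀ μ, 1 ≤ P μ)
    (x x' : ↥(boxDom (N0 ℓ Mh k P))) (μ : Fin (d + 1)) (hxx' : x'.1 = Function.update x.1 μ (x.1 μ + 1)) :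
    (geomR0 D).dist (blkOf D x) (blkOf D x') ≤ ((d : ℝ) + 1) * ℓ + 1 := by
  have hRM : 1 ≤ R * ((ℓ + 1) * Mh) := Nat.mul_pos hR (Nat.mul_pos (by omega) hMh)
  have hy : Function.update x.1 μ (x.1 μ + 1) ∈ cube 1 (ℓ + 1) (iota D (blkOf D x')).1.1 (iota D (blkOf D x')).1.2 := by
    rw [← hxx']
    exact mem_cube_blkOf D x'
  have h := dist_le_of_unitStep (dd := d + 1) (monotone_compl_of_antitone (antitone_OmExt D))
    (sepZd_of_cond22 (cond22_OmExt D hMh hP)) hRM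
    (tiles_printedDomains (by omega) (isUnionOfCubes_OmExt D hMh hP) (OmExt_zero D) (OmExt_succ D))
    Nat.one_pos (by omega) (mem_cube_blkOf D x) hy
  rw [geomR0_dist]
  have h' : (((latC 1 (ℓ + 1) (ZExt D)).dist (iota D (blkOf D x)) (iota D (blkOf D x')) : ℤ) : ℝ)
      ≤ (((d + 1 : ℕ) : ℤ) * (((ℓ + 1 : ℕ) : ℤ) - 1) + 1 : ℤ) := by exact_mod_cast h
  push_cast at h'
  linarith

/-- **TOUCHING BLOCKS ARE `κ`-CLOSE IN PRINT'S DISTANCE**: two blocks containing box sites at sup-distance `≤ 1` (one bond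
of p21's `bond D`, reading R2) are joined by at most `κ = (d+1)((d+1)(L−1) + 1)` admissible bonds of reading R0.
[cite: Balaban1984PropagatorsII, (2.46) p.231] -/
theorem distR0_le_of_near (hℓ : 1 ≤ ℓ) (hMh : 1 ≤ Mh) (hR : 1 ≤ R) (hP : ∀ μ, 1 ≤ P μ)
    {x x' : ↥(boxDom (N0 ℓ Mh k P))} (h : supNorm (x.1 - x'.1) ≤ 1) :
    (geomR0 D).dist (blkOf D x) (blkOf D x') ≤ kap d ℓ := by
  classical
  have htri := triangle254_R0 D hℓ hMh hR hP
  -- coordinates differ by at most one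
  have hc : ∀ ν, |x.1 ν - x'.1 ν| ≤ 1 := by
    intro ν
    have h1 := abs_le_supNorm (x.1 - x'.1) ν
    rw [Pi.sub_apply] at h1
    have : ((|x.1 ν - x'.1 ν| : ℤ) : ℝ) ≤ 1 := le_trans h1 h
    exact_mod_cast this
  -- move the coordinates of a set T one at a time
  suffices H : ∀ (T : Finset (Fin (d + 1))) (z z' : ↥(boxDom (N0 ℓ Mh k P))),
      (∀ ν, ν ∉ T → z.1 ν = z'.1 ν) → (∀ ν, |z.1 ν - z'.1 ν| ≤ 1) →
      (geomR0 D).dist (blkOf D z) (blkOf D z') ≤ T.card * (((d : ℝ) + 1) * ℓ + 1) by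
    have := H Finset.univ x x' (fun ν hν => absurd (Finset.mem_univ ν) hν) hc
    rw [Finset.card_univ, Fintype.card_fin] at this
    unfold kap
    push_cast at this
    exact this
  intro T
  induction T using Finset.induction_on with
  | empty =>
    intro z z' h0 _
    have : z = z' := Subtype.ext (funext fun ν => h0 ν (Finset.notMem_empty ν))
    subst this
    rw [(dist_R0_self_nonneg D (blkOf D z) (blkOf D z)).1]
    simp
  | @insert μ T hμT ih =>
    intro z z' h0 h1
    -- the intermediate site: coordinate μ moved to its target
    have hz₁mem : Function.update z.1 μ (z'.1 μ) ∈ boxDom (N0 ℓ Mh k P) := by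
      rw [mem_boxDom]
      intro ν
      by_cases hν : ν = μ
      · subst hν
        rw [Function.update_self]
        exact mem_boxDom.1 z'.2 ν
      · rw [Function.update_of_ne hν]
        exact mem_boxDom.1 z.2 ν
    set z₁ : ↥(boxDom (N0 ℓ Mh k P)) := ⟨Function.update z.1 μ (z'.1 μ), hz₁mem⟩ with hz₁def
    -- first leg: one unit move (or none)
    have hleg : (geomR0 D).dist (blkOf D z) (blkOf D z₁) ≤ ((d : ℝ) + 1) * ℓ + 1 := by
      have hκ0 : (0 : ℝ) ≤ ((d : ℝ) + 1) * ℓ + 1 := by positivity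
      have hμ1 := h1 μ
      rcases (show z'.1 μ = z.1 μ ∨ z'.1 μ = z.1 μ + 1 ∨ z'.1 μ = z.1 μ - 1 by
        rw [abs_le] at hμ1; omega) with he | he | he
      · have : z₁ = z := Subtype.ext (by rw [hz₁def]; simp only; rw [he, Function.update_eq_self])
        rw [this, (dist_R0_self_nonneg D (blkOf D z) (blkOf D z)).1]
        exact hκ0
      · exact distR0_le_of_unitStep D hℓ hMh hR hP z z₁ μ (by rw [hz₁def]; simp only; rw [he])
      · have hzz : z.1 = Function.update z₁.1 μ (z₁.1 μ + 1) := by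
          rw [hz₁def]
          simp only
          rw [Function.update_self, Function.update_idem, he, sub_add_cancel, Function.update_eq_self]
        have := distR0_le_of_unitStep D hℓ hMh hR hP z₁ z μ hzz
        rw [geomR0_dist, SimpleGraph.dist_comm, ← geomR0_dist] at this
        exact this
    -- second leg: induction
    have hrest := ih z₁ z' (fun ν hν => by
        by_cases hνμ : ν = μ
        · subst hνμ
          simp [hz₁def]
        · rw [hz₁def]
          simp only
          rw [Function.update_of_ne hνμ]
          exact h0 ν (by simp [hνμ, hν]))
      (fun ν => by
        by_cases hνμ : ν = μ
        · subst hνμ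
          simp [hz₁def]
        · rw [hz₁def]
          simp only
          rw [Function.update_of_ne hνμ]
          exact h1 ν)
    rw [Finset.card_insert_of_notMem hμT]
    push_cast
    calc (geomR0 D).dist (blkOf D z) (blkOf D z')
        ≤ (geomR0 D).dist (blkOf D z) (blkOf D z₁) + (geomR0 D).dist (blkOf D z₁) (blkOf D z') := htri _ _ _
      _ ≤ (((d : ℝ) + 1) * ℓ + 1) + T.card * (((d : ℝ) + 1) * ℓ + 1) := add_le_add hleg hrest
      _ = (T.card + 1) * (((d : ℝ) + 1) * ℓ + 1) := by ring

/-- the same for a bond of `bond D` (touching blocks). [cite: Balaban1984PropagatorsII, (2.46) p.231] -/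
theorem distR0_le_of_touch (hℓ : 1 ≤ ℓ) (hMh : 1 ≤ Mh) (hR : 1 ≤ R) (hP : ∀ μ, 1 ≤ P μ) {s t : ↥(bset D)}
    (h : Touch D s t) : (geomR0 D).dist s t ≤ kap d ℓ := by
  obtain ⟨x, x', hx, hx', hd⟩ := h
  subst hx
  subst hx'
  exact distR0_le_of_near D hℓ hMh hR hP hd

/-- **`d_R0 ≤ κ(d, L)·d_R2` ON THE BLOCKS OF THE BOX**: print's distance (2.46) read literally is at most `κ` times the
touching-block distance of p21's `geom D` (and `d_R2 ≤ d_R0` pointwise, GAPS G-B6-22) — along a geodesic of `bond D`.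
[cite: Balaban1984PropagatorsII, (2.46) p.231] -/
theorem distR0_le_mul_distR2 (hℓ : 1 ≤ ℓ) (hMh : 1 ≤ Mh) (hR : 1 ≤ R) (hP : ∀ μ, 1 ≤ P μ) (s t : ↥(bset D)) :
    (geomR0 D).dist s t ≤ kap d ℓ * (geom D).dist s t := by
  have htri := triangle254_R0 D hℓ hMh hR hP
  obtain ⟨p, hp⟩ := (B6Geom246MultiLevelBox.connected (D := D) hMh hP).exists_walk_length_eq_dist s t
  suffices H : ∀ (u v : ↥(bset D)) (q : (bond D).Walk u v), (geomR0 D).dist u v ≤ kap d ℓ * q.length by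
    have := H s t p
    rw [hp] at this
    exact this
  intro u v q
  induction q with
  | @nil a =>
    rw [(dist_R0_self_nonneg D a a).1]
    simp
  | @cons a b c hadj q ih =>
    have h1 : (geomR0 D).dist a b ≤ kap d ℓ := distR0_le_of_touch D hℓ hMh hR hP (bond_adj.1 hadj).2
    rw [SimpleGraph.Walk.length_cons]
    push_cast
    calc (geomR0 D).dist a c ≤ (geomR0 D).dist a b + (geomR0 D).dist b c := htri _ _ _
      _ ≤ kap d ℓ + kap d ℓ * q.length := add_le_add h1 ih
      _ = kap d ℓ * (q.length + 1) := by ring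

/-- the exponential factor of (2.67)/(2.87) in print's distance dominates the one in the touching distance at the rate
`δ/κ`: `e^{−½δ·d_R2} ≤ e^{−½(δ/κ)·d_R0}`. [cite: Balaban1984PropagatorsII, (2.67) p.234, (2.87) p.238] -/
theorem exp_R2_le_exp_R0 (hℓ : 1 ≤ ℓ) (hMh : 1 ≤ Mh) (hR : 1 ≤ R) (hP : ∀ μ, 1 ≤ P μ) {δ : ℝ} (hδ : 0 ≤ δ)
    (s t : ↥(bset D)) :
    Real.exp (-(δ / 2 * (geom D).dist s t)) ≤ Real.exp (-(δ / kap d ℓ / 2 * (geomR0 D).dist s t)) := by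
  have hκ := kap_pos d ℓ
  have h := distR0_le_mul_distR2 D hℓ hMh hR hP s t
  rw [Real.exp_le_exp, neg_le_neg_iff]
  have : δ / kap d ℓ / 2 * (geomR0 D).dist s t ≤ δ / kap d ℓ / 2 * (kap d ℓ * (geom D).dist s t) :=
    mul_le_mul_of_nonneg_left h (by positivity)
  calc δ / kap d ℓ / 2 * (geomR0 D).dist s t ≤ δ / kap d ℓ / 2 * (kap d ℓ * (geom D).dist s t) := this
    _ = δ / 2 * (geom D).dist s t := by field_simp

end Compare

/-! ## §3 Proposition 2.2 and Proposition 2.3 on the census family with print's distance (R0) -/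

section Census

variable {ℓ : ℕ} (i : KIdx d ℓ)

/-- the (2.67) functionals of the member, re-typed over `geoR0P i` (same `Loc`, `Site`, `Cut`).
[cite: Balaban1984PropagatorsII, Prop. 2.2 (2.67) p.234, dictionary] -/
def gpR0P : GpFamily (geoR0P i) := ⟨(gpP i).e, (gpP i).h1⟩

/-- the (2.87) kernel of the member, re-typed over `geoR0P i`. [cite: Balaban1984PropagatorsII, (2.87) p.238, dictionary] -/
def CinvR0P : SiteKernel (geoR0P i) := ⟨(CinvP i).ker⟩

/-- `|λ| ≥ 0` for the census sup norm. [folklore] -/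
private theorem supF_nonneg (f : ↥(i.XB) → ℝ) : 0 ≤ i.supF f := by
  unfold KIdx.supF
  exact le_ciSup_of_le (Set.finite_range _).bddAbove i.origin (abs_nonneg _)

/-- `pref4 t n ≥ 0` for `t ≥ 0`. [folklore] -/
private theorem pref4_nonneg {t : ℝ} (ht : 0 ≤ t) (n : Fin 4) : 0 ≤ pref4 t n := by
  fin_cases n <;> simp [pref4] <;> positivity

/-- the geodesic comparison on a census member: `e^{−½δ d_R2} ≤ e^{−½(δ/κ) d_R0}`. [cite: Balaban1984PropagatorsII, (2.67) p.234] -/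
theorem exp_geoP_le_exp_geoR0P (hℓ : 1 ≤ ℓ) {δ : ℝ} (hδ : 0 ≤ δ) (y y' : ↥(bset i.D)) :
    Real.exp (-(δ / 2 * (geoP i).dist y y')) ≤ Real.exp (-(δ / kap d ℓ / 2 * (geoR0P i).dist y y')) :=
  exp_R2_le_exp_R0 i.D hℓ i.hMh (le_trans (by omega) i.hR) i.hP hδ y y'

/-- **PROPOSITION 2.2 (2.67), THE CENSUS SENTENCE `B6.Prop22Printed`, ON THE GENUINE `k`-LEVEL FAMILY WITH PRINT'S
DISTANCE (2.46) READ LITERALLY**: both conjuncts (the four sup entries and the Hölder entries, one `M₁`, one `δ₀`, all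
`α < 1`), transported from p21's `prop22Printed_kLevelP` (touching distance, rate `δ₀`) at the rate `δ₀/κ(d, L)` by
`d_R0 ≤ κ·d_R2`. [cite: Balaban1984PropagatorsII, Prop. 2.2 (2.67) p.234, (2.46) p.231] -/
theorem prop22Printed_kLevelR0P (d ℓ : ℕ) (hℓ : 1 ≤ ℓ) :
    Prop22Printed (fun i : KIdx d ℓ => geoR0P i) (fun i => gpR0P i) := by
  obtain ⟨M₁, δ₀, C, Cα, hM₁, hδ₀, hC, h⟩ := prop22Printed_kLevelP d ℓ hℓ
  refine ⟨M₁, δ₀ / kap d ℓ, C, fun α => max (Cα α) 0, hM₁, div_pos hδ₀ (kap_pos d ℓ), hC, ?_⟩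
  intro i hH hM
  obtain ⟨h1, h2⟩ := h i hH hM
  constructor
  · intro n lam y y' hsupp
    have hb := h1 n lam y y' hsupp
    have hlen : 0 ≤ (geoP i).len y := (len_pos i y).le
    have hsup : 0 ≤ (geoP i).supNorm lam := supF_nonneg i lam
    calc (gpR0P i).e n lam y = (gpP i).e n lam y := rfl
      _ ≤ C * pref4 ((geoP i).len y) n * Real.exp (-(δ₀ / 2 * (geoP i).dist y y')) * (geoP i).supNorm lam := hb
      _ ≤ C * pref4 ((geoP i).len y) n * Real.exp (-(δ₀ / kap d ℓ / 2 * (geoR0P i).dist y y'))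
          * (geoP i).supNorm lam := by
          have := exp_geoP_le_exp_geoR0P i hℓ hδ₀.le y y'
          have h0 : 0 ≤ C * pref4 ((geoP i).len y) n := mul_nonneg hC.le (pref4_nonneg hlen n)
          gcongr
  · intro α lam ζ y y' hα0 hα1 hcut hsupp
    have hb := h2 α lam ζ y y' hα0 hα1 hcut hsupp
    have hlen : 0 < (geoP i).len y := len_pos i y
    have hsup : 0 ≤ (geoP i).supNorm lam := supF_nonneg i lam
    have hcutH : 0 ≤ (geoP i).cutH α ζ := add_nonneg (hqP_nonneg i α ζ) (supF_nonneg i ζ)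
    have hX : 0 ≤ ((geoP i).len y) ^ (1 - α) * (geoP i).cutH α ζ
        * Real.exp (-(δ₀ / 2 * (geoP i).dist y y')) * (geoP i).supNorm lam := by
      have := Real.rpow_nonneg hlen.le (1 - α)
      positivity
    calc (gpR0P i).h1 lam α ζ = (gpP i).h1 lam α ζ := rfl
      _ ≤ Cα α * ((geoP i).len y) ^ (1 - α) * (geoP i).cutH α ζ
          * Real.exp (-(δ₀ / 2 * (geoP i).dist y y')) * (geoP i).supNorm lam := hb
      _ = Cα α * (((geoP i).len y) ^ (1 - α) * (geoP i).cutH α ζ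
          * Real.exp (-(δ₀ / 2 * (geoP i).dist y y')) * (geoP i).supNorm lam) := by ring
      _ ≤ max (Cα α) 0 * (((geoP i).len y) ^ (1 - α) * (geoP i).cutH α ζ
          * Real.exp (-(δ₀ / 2 * (geoP i).dist y y')) * (geoP i).supNorm lam) :=
          mul_le_mul_of_nonneg_right (le_max_left _ _) hX
      _ ≤ max (Cα α) 0 * (((geoP i).len y) ^ (1 - α) * (geoP i).cutH α ζ
          * Real.exp (-(δ₀ / kap d ℓ / 2 * (geoR0P i).dist y y')) * (geoP i).supNorm lam) := by
          have := exp_geoP_le_exp_geoR0P i hℓ hδ₀.le y y'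
          have h0 : 0 ≤ max (Cα α) 0 := le_max_right _ _
          have h1' : 0 ≤ ((geoP i).len y) ^ (1 - α) * (geoP i).cutH α ζ :=
            mul_nonneg (Real.rpow_nonneg hlen.le _) hcutH
          gcongr
      _ = max (Cα α) 0 * ((geoP i).len y) ^ (1 - α) * (geoP i).cutH α ζ
          * Real.exp (-(δ₀ / kap d ℓ / 2 * (geoR0P i).dist y y')) * (geoP i).supNorm lam := by ring

/-- **PROPOSITION 2.3 (2.87), THE CENSUS SENTENCE `B6.Prop23Printed`, ON THE GENUINE `k`-LEVEL FAMILY WITH PRINT'S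
DISTANCE (2.46) READ LITERALLY** (rate `δ₁/κ(d, L)`), transported from p21's `prop23Printed_kLevelP`.
[cite: Balaban1984PropagatorsII, Prop. 2.3 (2.86)–(2.87) p.238, (2.46) p.231] -/
theorem prop23Printed_kLevelR0P (d ℓ : ℕ) (hℓ : 1 ≤ ℓ) :
    Prop23Printed (d + 1) (fun i : KIdx d ℓ => geoR0P i) (fun i => CinvR0P i) := by
  obtain ⟨M₁, δ₁, C, hM₁, hδ₁, hC, h⟩ := prop23Printed_kLevelP d ℓ hℓ
  refine ⟨M₁, δ₁ / kap d ℓ, C, hM₁, div_pos hδ₁ (kap_pos d ℓ), hC, fun i hH hM y y' => ?_⟩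
  have hb := h i hH hM y y'
  have hl : 0 < (geoP i).len y := len_pos i y
  have hl' : 0 < (geoP i).len y' := len_pos i y'
  have h0 : 0 ≤ C * ((geoP i).len y) ^ (-(4 : ℝ)) * ((geoP i).len y') ^ (-((d + 1 : ℕ) : ℝ)) :=
    mul_nonneg (mul_nonneg hC.le (Real.rpow_nonneg hl.le _)) (Real.rpow_nonneg hl'.le _)
  calc |(CinvR0P i).ker y y'| = |(CinvP i).ker y y'| := rfl
    _ ≤ C * ((geoP i).len y) ^ (-(4 : ℝ)) * ((geoP i).len y') ^ (-((d + 1 : ℕ) : ℝ))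
        * Real.exp (-(δ₁ / 2 * (geoP i).dist y y')) := hb
    _ ≤ C * ((geoP i).len y) ^ (-(4 : ℝ)) * ((geoP i).len y') ^ (-((d + 1 : ℕ) : ℝ))
        * Real.exp (-(δ₁ / kap d ℓ / 2 * (geoR0P i).dist y y')) :=
        mul_le_mul_of_nonneg_left (exp_geoP_le_exp_geoR0P i hℓ hδ₁.le y y') h0

/-- **THE `k`-LEVEL PARTIAL KNIT ON ONE FAMILY** (B6-CLOSURE §5 item 1): on the genuine `k`-level family in print's units
with print's distance (2.46) read literally, THREE conjuncts of `DagBinding.B6BlockParam` hold together — Lemma 2.1 in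
parameter form (d-only c₁″, every `δ₀ > 0`), Prop. 2.2 (2.67) and Prop. 2.3 (2.87) as the census sentences.
[cite: Balaban1984PropagatorsII, Lemma 2.1 p.234, Prop. 2.2 p.234, Prop. 2.3 p.238] -/
theorem knit_lemma21_prop22_prop23_kLevelR0P (d ℓ : ℕ) (hℓ : 1 ≤ ℓ) {δ₀ : ℝ} (hδ : 0 < δ₀) :
    (∃ c₁ : ℝ → ℝ, ∀ i : KIdx d ℓ, (geoR0P i).Hyp21_22 → ∀ α : ℝ, 0 < α → α < 1 →
      Cond259 (d + 1) δ₀ α (geoR0P i).R (geoR0P i).M →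
        Ineq260 (geoR0P i) δ₀ α ∧ Ineq261With (c₁ α) (geoR0P i) δ₀ α) ∧
    Prop22Printed (fun i : KIdx d ℓ => geoR0P i) (fun i => gpR0P i) ∧
    Prop23Printed (d + 1) (fun i : KIdx d ℓ => geoR0P i) (fun i => CinvR0P i) :=
  ⟨lemma21Param_kLevelR0 d ℓ hℓ hδ, prop22Printed_kLevelR0P d ℓ hℓ, prop23Printed_kLevelR0P d ℓ hℓ⟩

end Census

/-! ## §4 (v1.1) Non-vacuity of the knit: members beyond every threshold meeting `Hyp21_22` AND (2.59) -/

section NonVacuity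

open Literature.MathematicalPhysics.QuantumFieldTheory.Balaban1983to89.B6 (c0)
open Literature.MathematicalPhysics.QuantumFieldTheory.Balaban1983to89.B6Prop22KLevelCensus (kLevel_nonvacuous3)
open Literature.MathematicalPhysics.QuantumFieldTheory.Balaban1983to89.B6Prop22KLevelCensusEta (kLevelP_nonvacuous)

/-- (2.59) with the `(d+1)`-dimensional constant from `R ≥ 2` and an explicit threshold on `M`: with
`T = 2(d+1) log c₀(½α) + 1`, `M ≥ 4|T|/(αδ₀) + 1` gives `¼αδ₀RM ≥ ½αδ₀M > 2|T| ≥ T`.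
[cite: Balaban1984PropagatorsII, (2.59) p.233 («Now we require that RM is sufficiently large»), dictionary] -/
private theorem cond259_of_threshold {δ₀ α R M : ℝ} (hδ : 0 < δ₀) (hα : 0 < α) (hR : 2 ≤ R)
    (hM : 4 * |2 * ((d + 1 : ℕ) : ℝ) * Real.log (c0 δ₀ (α / 2)) + 1| / (α * δ₀) + 1 ≤ M) :
    Cond259 (d + 1) δ₀ α R M := by
  set T : ℝ := 2 * ((d + 1 : ℕ) : ℝ) * Real.log (c0 δ₀ (α / 2)) + 1 with hT_def
  have hαδ : 0 < α * δ₀ := mul_pos hα hδ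
  have hdiv : 4 * |T| / (α * δ₀) < M := by linarith
  have h1 : 4 * |T| < M * (α * δ₀) := (div_lt_iff₀ hαδ).mp hdiv
  have hM0 : 0 ≤ M := by
    have : 0 ≤ 4 * |T| / (α * δ₀) := div_nonneg (by positivity) hαδ.le
    linarith
  have h3 : α * δ₀ * M * 2 ≤ α * δ₀ * M * R := mul_le_mul_of_nonneg_left hR (mul_nonneg hαδ.le hM0)
  have hT : T ≤ |T| := le_abs_self T
  have hTnn : 0 ≤ |T| := abs_nonneg T
  show T < 1 / 4 * α * δ₀ * R * M
  nlinarith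

/-- **NON-VACUITY OF THE KNIT** (two top levels): for every `k ≥ 2`, every threshold `M₁` and all `δ₀, α > 0` the family
has a member with `k` levels and `M ≥ M₁` meeting BOTH hypotheses of the first conjunct of
`knit_lemma21_prop22_prop23_kLevelR0P` ∕ `lemma21Param_kLevelR0` — `Hyp21_22` and (2.59) `Cond259 (d+1) δ₀ α R M` — and the
hypotheses `M ≥ M₁`, `Hyp21_22` of the census sentences, whose geometry has blocks at BOTH top levels `k` and `k − 1`: Lemma 2.1,
Prop. 2.2 and Prop. 2.3 with print's distance (2.46) are asserted of genuine multi-level members beyond every threshold, not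
vacuously (r03's `kLevelP_nonvacuous` witness read over `geoR0P`; (2.59) by `M` large at the member's `R ≥ 2L ≥ 2`,
`cond259_of_threshold`). [cite: Balaban1984PropagatorsII, (2.59) p.233 («Now we require that RM is sufficiently large»),
Lemma 2.1 p.234, Prop. 2.2 p.234 («M is sufficiently large»); (2.1)–(2.2) p.224] -/
theorem knit_kLevelR0P_nonvacuous (d ℓ k : ℕ) (hk : 2 ≤ k) (M₁ : ℝ) {δ₀ α : ℝ} (hδ : 0 < δ₀) (hα : 0 < α) :
    ∃ i : KIdx d ℓ, i.k = k ∧ M₁ ≤ (geoR0P i).M ∧ (geoR0P i).Hyp21_22 ∧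
      Cond259 (d + 1) δ₀ α (geoR0P i).R (geoR0P i).M ∧
      (∃ s : (geoR0P i).Site, (geoR0P i).scale s = k) ∧ (∃ s : (geoR0P i).Site, (geoR0P i).scale s = k - 1) := by
  obtain ⟨i, hik, hM, hH, hs1, hs2⟩ := kLevelP_nonvacuous d ℓ k hk
    (max M₁ (4 * |2 * ((d + 1 : ℕ) : ℝ) * Real.log (c0 δ₀ (α / 2)) + 1| / (α * δ₀) + 1))
  have hM' : max M₁ (4 * |2 * ((d + 1 : ℕ) : ℝ) * Real.log (c0 δ₀ (α / 2)) + 1| / (α * δ₀) + 1) ≤ (geoR0P i).M := hM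
  have hR : (2 : ℝ) ≤ (geoR0P i).R := by
    rw [geoR0P_R]; exact_mod_cast le_trans (by omega : 2 ≤ 2 * (ℓ + 1)) i.hR
  exact ⟨i, hik, (le_max_left _ _).trans hM', hH, cond259_of_threshold hδ hα hR ((le_max_right _ _).trans hM'), hs1, hs2⟩

/-- **NON-VACUITY OF THE KNIT WITH (2.2) ACTIVE** (three top levels, gen 12's `kLevel_nonvacuous3` witness read over
`geoR0P`): for every `k ≥ 3`, every `M₁` and all `δ₀, α > 0` a member with `k` levels, `M ≥ M₁`, `Hyp21_22`, (2.59), and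
blocks at the THREE levels `k`, `k − 1`, `k − 2` — so the separation (2.2) with print's `RM` constrains the member
non-trivially. [cite: Balaban1984PropagatorsII, (2.1)–(2.2) p.224, (2.59) p.233, Lemma 2.1 + Prop. 2.2 p.234] -/
theorem knit_kLevelR0P_nonvacuous3 (d ℓ k : ℕ) (hℓ : 1 ≤ ℓ) (hk : 3 ≤ k) (M₁ : ℝ) {δ₀ α : ℝ} (hδ : 0 < δ₀)
    (hα : 0 < α) :
    ∃ i : KIdx d ℓ, i.k = k ∧ M₁ ≤ (geoR0P i).M ∧ (geoR0P i).Hyp21_22 ∧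
      Cond259 (d + 1) δ₀ α (geoR0P i).R (geoR0P i).M ∧
      (∃ s : (geoR0P i).Site, (geoR0P i).scale s = k) ∧ (∃ s : (geoR0P i).Site, (geoR0P i).scale s = k - 1) ∧
        (∃ s : (geoR0P i).Site, (geoR0P i).scale s = k - 2) := by
  obtain ⟨i, hik, hM, hH, hs1, hs2, hs3⟩ := kLevel_nonvacuous3 d ℓ k hℓ hk
    (max M₁ (4 * |2 * ((d + 1 : ℕ) : ℝ) * Real.log (c0 δ₀ (α / 2)) + 1| / (α * δ₀) + 1))
  have hM' : max M₁ (4 * |2 * ((d + 1 : ℕ) : ℝ) * Real.log (c0 δ₀ (α / 2)) + 1| / (α * δ₀) + 1) ≤ (geoR0P i).M := hM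
  have hR : (2 : ℝ) ≤ (geoR0P i).R := by
    rw [geoR0P_R]; exact_mod_cast le_trans (by omega : 2 ≤ 2 * (ℓ + 1)) i.hR
  exact ⟨i, hik, (le_max_left _ _).trans hM', hH, cond259_of_threshold hδ hα hR ((le_max_right _ _).trans hM'), hs1,
    hs2, hs3⟩

/-- **THE KNIT, NON-VACUOUSLY**: `knit_lemma21_prop22_prop23_kLevelR0P` (Lemma 2.1 in parameter form ∧ Prop. 2.2 (2.67) ∧
Prop. 2.3 (2.87) as the census sentences, on ONE genuine `k`-level family with print's distance) TOGETHER WITH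
`knit_kLevelR0P_nonvacuous` (for every `k ≥ 2`, threshold and `α > 0` a genuine two-top-level member meeting `M ≥ M₁`,
`Hyp21_22` and (2.59)). [cite: Balaban1984PropagatorsII, Lemma 2.1 p.234, Prop. 2.2 (2.67) p.234, Prop. 2.3 (2.87) p.238,
(2.59) p.233] -/
theorem knit_kLevelR0P_with_nonvacuity (d ℓ : ℕ) (hℓ : 1 ≤ ℓ) {δ₀ : ℝ} (hδ : 0 < δ₀) :
    ((∃ c₁ : ℝ → ℝ, ∀ i : KIdx d ℓ, (geoR0P i).Hyp21_22 → ∀ α : ℝ, 0 < α → α < 1 →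
        Cond259 (d + 1) δ₀ α (geoR0P i).R (geoR0P i).M →
          Ineq260 (geoR0P i) δ₀ α ∧ Ineq261With (c₁ α) (geoR0P i) δ₀ α) ∧
      Prop22Printed (fun i : KIdx d ℓ => geoR0P i) (fun i => gpR0P i) ∧
      Prop23Printed (d + 1) (fun i : KIdx d ℓ => geoR0P i) (fun i => CinvR0P i)) ∧
    (∀ k : ℕ, 2 ≤ k → ∀ M₁ : ℝ, ∀ α : ℝ, 0 < α →
      ∃ i : KIdx d ℓ, i.k = k ∧ M₁ ≤ (geoR0P i).M ∧ (geoR0P i).Hyp21_22 ∧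
        Cond259 (d + 1) δ₀ α (geoR0P i).R (geoR0P i).M ∧
        (∃ s : (geoR0P i).Site, (geoR0P i).scale s = k) ∧ (∃ s : (geoR0P i).Site, (geoR0P i).scale s = k - 1)) :=
  ⟨knit_lemma21_prop22_prop23_kLevelR0P d ℓ hℓ hδ, fun k hk M₁ _ hα => knit_kLevelR0P_nonvacuous d ℓ k hk M₁ hδ hα⟩

end NonVacuity

/-! ## §5 (v1.2) The converse comparison `d_R2 ≤ d_R0`: the two readings are equivalent up to `κ(d, L)` on the box -/

section Converse

open Literature.MathematicalPhysics.QuantumFieldTheory.Balaban1983to89.B15Ineq147LevelGap (corner_mem_cube toR)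
open Literature.MathematicalPhysics.QuantumFieldTheory.Balaban1983to89.B15Ineq147Admissible (Touching)
open Literature.MathematicalPhysics.QuantumFieldTheory.Balaban1983to89.B15LatticeCubeContours (touching_of_latStep)
open Literature.MathematicalPhysics.QuantumFieldTheory.Balaban1983to89.B15TouchingCubeContours (touching_symm)
open Literature.MathematicalPhysics.QuantumFieldTheory.Balaban1983to89.B6Geom246MultiLevelBox (blkOf_val)

variable {ℓ Mh k R : ℕ} {P : Fin (d + 1) → ℕ} (D : Domains d ℓ Mh k P R)

/-- a point of an `Lⁿ`-cube of the extension has that cube as its `Lⁿ`-block index. [cite: Balaban1984PropagatorsII, (2.45)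
p.231, dictionary] -/
private theorem blk_eq_of_mem_cube {n : ℕ} {c x : Fin (d + 1) → ℤ} (hx : x ∈ cube 1 (ℓ + 1) n c) :
    blk ((ℓ + 1) ^ n) x = c := by
  have hs : 0 < 1 * (ℓ + 1) ^ n := by positivity
  have h := (mem_cube_iff_cubeIdx hs).1 hx
  rw [Nat.one_mul] at h
  exact h

/-- the extended level function is the scale on every cube-site of the extension (its cube lies in the territory
`Z_{n+1} ∖ Z_n = Ω_n ∖ Ω_{n+1}`). [cite: Balaban1984PropagatorsII, (2.3)–(2.4) p.224, dictionary] -/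
private theorem levExt_eq_zoneC (u : CubeSite 1 (ℓ + 1) (ZExt D)) {x : Fin (d + 1) → ℤ}
    (hx : x ∈ cube 1 (ℓ + 1) u.1.1 u.1.2) : levExt D x = zoneC u := by
  have h := u.2 hx
  have h1 := h.1
  have h2 := h.2
  simp only [Set.mem_compl_iff, mem_OmExt, not_le] at h1 h2
  simp only [zoneC]
  omega

/-- **THE BLOCK UNDER A CUBE-SITE OF THE EXTENSION**: clamp the cube's corner into the box and take its block (for the
cube-sites inside the box — the image of `iota` — this is the block itself, `projB_iota`). [cite: Balaban1984PropagatorsII,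
(2.45) p.231 («𝔅 = ⋃_j Λ_j»), dictionary] -/
def projB (hMh : 1 ≤ Mh) (hP : ∀ μ, 1 ≤ P μ) (u : CubeSite 1 (ℓ + 1) (ZExt D)) : ↥(bset D) :=
  blkOf D ⟨clampV (N0 ℓ Mh k P) (cornerC u), clampV_mem (one_le_N0 hMh hP) _⟩

/-- every point of the cube of `u` clamps into the block `projB u` (the clamp respects the `Lⁿ`-grid, `blk_clampV_eq`, and the
extended level is the scale on the cube). [cite: Balaban1984PropagatorsII, (2.45) p.231, dictionary] -/
private theorem blkOf_clampV_eq_projB (hMh : 1 ≤ Mh) (hP : ∀ μ, 1 ≤ P μ) (u : CubeSite 1 (ℓ + 1) (ZExt D))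
    {x : Fin (d + 1) → ℤ} (hx : x ∈ cube 1 (ℓ + 1) u.1.1 u.1.2) :
    blkOf D ⟨clampV (N0 ℓ Mh k P) x, clampV_mem (one_le_N0 hMh hP) _⟩ = projB D hMh hP u := by
  have hside : 0 < 1 * (ℓ + 1) ^ u.1.1 := by positivity
  have hc : cornerC u ∈ cube 1 (ℓ + 1) u.1.1 u.1.2 := corner_mem_cube hside _
  have hlx : D.lev (clampV (N0 ℓ Mh k P) x) = u.1.1 := levExt_eq_zoneC D u hx
  have hlc : D.lev (clampV (N0 ℓ Mh k P) (cornerC u)) = u.1.1 := levExt_eq_zoneC D u hc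
  have hk : u.1.1 ≤ k := hlx ▸ D.lev_le _
  have hb : blk ((ℓ + 1) ^ u.1.1) (clampV (N0 ℓ Mh k P) x) = blk ((ℓ + 1) ^ u.1.1) (clampV (N0 ℓ Mh k P) (cornerC u)) :=
    blk_clampV_eq (Nat.one_le_pow _ _ (by omega)) (pow_dvd_N0 hk) (one_le_N0 hMh hP)
      ((blk_eq_of_mem_cube hx).trans (blk_eq_of_mem_cube hc).symm)
  unfold projB
  apply Subtype.ext
  rw [blkOf_val, blkOf_val, hlx, hlc, hb]

/-- the block under an embedded block is the block itself. [cite: Balaban1984PropagatorsII, (2.45) p.231, dictionary] -/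
theorem projB_iota (hMh : 1 ≤ Mh) (hP : ∀ μ, 1 ≤ P μ) (s : ↥(bset D)) : projB D hMh hP (iota D s) = s := by
  have hside : 0 < 1 * (ℓ + 1) ^ s.1.1 := by positivity
  have hc : cornerC (iota D s) ∈ cube 1 (ℓ + 1) s.1.1 s.1.2 := corner_mem_cube hside _
  obtain ⟨hmem, hblk⟩ := mem_box_of_mem_cube D s hc
  have h1 : (⟨clampV (N0 ℓ Mh k P) (cornerC (iota D s)), clampV_mem (one_le_N0 hMh hP) _⟩ :
      ↥(boxDom (N0 ℓ Mh k P))) = ⟨cornerC (iota D s), hmem⟩ := Subtype.ext (clampV_of_mem hmem)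
  unfold projB
  rw [h1]
  exact (blkOf_eq_iff_blk D).2 hblk

/-- **ONE ADMISSIBLE BOND OF THE EXTENSION PROJECTS TO EQUAL OR TOUCHING BLOCKS**: a `Λ_n`-bond joins cubes with lattice
points at sup-distance `≤ 1` (p29's `touching_of_latStep`), the clamp is 1-Lipschitz (`supNorm_clampV_sub_le`), and the
clamped points lie in the projected blocks. [cite: Balaban1984PropagatorsII, (2.46) p.231] -/
theorem projB_adj (hMh : 1 ≤ Mh) (hP : ∀ μ, 1 ≤ P μ) {u v : CubeSite 1 (ℓ + 1) (ZExt D)}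
    (h : (latC 1 (ℓ + 1) (ZExt D)).Adj u v) :
    projB D hMh hP u = projB D hMh hP v ∨ (bond D).Adj (projB D hMh hP u) (projB D hMh hP v) := by
  have hT : Touching u v := by
    obtain ⟨_, h1 | h1⟩ := latC_adj.1 h
    · exact touching_of_latStep Nat.one_pos (Nat.succ_pos ℓ) h1
    · exact touching_symm (touching_of_latStep Nat.one_pos (Nat.succ_pos ℓ) h1)
  obtain ⟨p, hp, q, hq, hpq⟩ := hT
  by_cases heq : projB D hMh hP u = projB D hMh hP v
  · exact Or.inl heq
  refine Or.inr (bond_adj.2 ⟨heq, ⟨clampV (N0 ℓ Mh k P) p, clampV_mem (one_le_N0 hMh hP) _⟩,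
    ⟨clampV (N0 ℓ Mh k P) q, clampV_mem (one_le_N0 hMh hP) _⟩, blkOf_clampV_eq_projB D hMh hP u hp,
    blkOf_clampV_eq_projB D hMh hP v hq, ?_⟩)
  calc supNorm (clampV (N0 ℓ Mh k P) p - clampV (N0 ℓ Mh k P) q) ≤ supNorm (p - q) := supNorm_clampV_sub_le _ _ _
    _ ≤ 1 := by
      obtain ⟨i, hi⟩ := exists_supNorm_eq (p - q)
      have := (dist_pi_le_iff zero_le_one).1 hpq i
      rw [Real.dist_eq] at this
      rw [hi, Pi.sub_apply, Int.cast_abs, Int.cast_sub]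
      simpa [toR] using this

/-- an admissible contour of the extension projects to a chain of equal-or-touching blocks of at most the same length.
[cite: Balaban1984PropagatorsII, (2.46) p.231, dictionary] -/
private theorem exists_bond_walk (hMh : 1 ≤ Mh) (hP : ∀ μ, 1 ≤ P μ) {u w : CubeSite 1 (ℓ + 1) (ZExt D)}
    (p : (latC 1 (ℓ + 1) (ZExt D)).Walk u w) :
    ∃ q : (bond D).Walk (projB D hMh hP u) (projB D hMh hP w), q.length ≤ p.length := by
  induction p with
  | nil => exact ⟨SimpleGraph.Walk.nil, le_rfl⟩
  | cons hadj p ih =>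
    obtain ⟨q, hq⟩ := ih
    rcases projB_adj D hMh hP hadj with heq | hadj'
    · refine ⟨q.copy heq.symm rfl, ?_⟩
      rw [SimpleGraph.Walk.length_copy, SimpleGraph.Walk.length_cons]
      omega
    · refine ⟨SimpleGraph.Walk.cons hadj' q, ?_⟩
      rw [SimpleGraph.Walk.length_cons, SimpleGraph.Walk.length_cons]
      omega

/-- **`d_R2 ≤ d_R0` ON THE BLOCKS OF THE BOX** (GAPS G-B6-22's pointwise remark, certified for the genuine `k`-level family):
print's admissible-contour distance (2.46) read literally (R0, contours of `Λ_n`-bonds in the clamp extension) is at least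
the touching-block distance (R2) — project a shortest admissible contour bond by bond (`projB_adj`). With
`distR0_le_mul_distR2`: `d_R2 ≤ d_R0 ≤ κ(d, L)·d_R2`. [cite: Balaban1984PropagatorsII, (2.46) p.231] -/
theorem distR2_le_distR0 (hℓ : 1 ≤ ℓ) (hMh : 1 ≤ Mh) (hR : 1 ≤ R) (hP : ∀ μ, 1 ≤ P μ) (s t : ↥(bset D)) :
    (geom D).dist s t ≤ (geomR0 D).dist s t := by
  obtain ⟨p, hp⟩ := (connected_R0 D hℓ hMh hR hP).exists_walk_length_eq_dist (iota D s) (iota D t)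
  obtain ⟨q, hq⟩ := exists_bond_walk D hMh hP p
  have h1 : (bond D).dist s t ≤ p.length := by
    have := SimpleGraph.dist_le (q.copy (projB_iota D hMh hP s) (projB_iota D hMh hP t))
    rw [SimpleGraph.Walk.length_copy] at this
    exact this.trans hq
  show ((bond D).dist s t : ℝ) ≤ (((latC 1 (ℓ + 1) (ZExt D)).dist (iota D s) (iota D t) : ℕ) : ℝ)
  rw [← hp]
  exact_mod_cast h1

/-- **THE TWO READINGS OF (2.46) ARE EQUIVALENT UP TO `κ(d, L)` ON THE GENUINE `k`-LEVEL BOX FAMILY**: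
`d_R2 ≤ d_R0 ≤ κ·d_R2`, `κ = (d+1)((d+1)(L−1)+1)`. [cite: Balaban1984PropagatorsII, (2.46) p.231] -/
theorem distR2_le_distR0_le_mul (hℓ : 1 ≤ ℓ) (hMh : 1 ≤ Mh) (hR : 1 ≤ R) (hP : ∀ μ, 1 ≤ P μ) (s t : ↥(bset D)) :
    (geom D).dist s t ≤ (geomR0 D).dist s t ∧ (geomR0 D).dist s t ≤ kap d ℓ * (geom D).dist s t :=
  ⟨distR2_le_distR0 D hℓ hMh hR hP s t, distR0_le_mul_distR2 D hℓ hMh hR hP s t⟩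

/-- hence the exponential factor in print's distance is dominated by the one in the touching distance AT THE SAME RATE:
`e^{−½δ·d_R0} ≤ e^{−½δ·d_R2}` (`δ ≥ 0`) — every decay estimate in the R0 distance implies the same estimate in the R2
distance with the same rate (and conversely at the rate `δ/κ`, `exp_R2_le_exp_R0`). [cite: Balaban1984PropagatorsII, (2.67)
p.234, (2.87) p.238] -/
theorem exp_R0_le_exp_R2 (hℓ : 1 ≤ ℓ) (hMh : 1 ≤ Mh) (hR : 1 ≤ R) (hP : ∀ μ, 1 ≤ P μ) {δ : ℝ} (hδ : 0 ≤ δ)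
    (s t : ↥(bset D)) :
    Real.exp (-(δ / 2 * (geomR0 D).dist s t)) ≤ Real.exp (-(δ / 2 * (geom D).dist s t)) := by
  apply Real.exp_le_exp.2
  have := distR2_le_distR0 D hℓ hMh hR hP s t
  nlinarith

end Converse

section ConverseCensus

variable {ℓ : ℕ} (i : KIdx d ℓ)

/-- on a census member: `d_R2 ≤ d_R0 ≤ κ·d_R2` between `geoP i` (touching distance) and `geoR0P i` (print's distance).
[cite: Balaban1984PropagatorsII, (2.46) p.231] -/
theorem dist_geoP_le_dist_geoR0P_le (hℓ : 1 ≤ ℓ) (y y' : ↥(bset i.D)) :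
    (geoP i).dist y y' ≤ (geoR0P i).dist y y' ∧ (geoR0P i).dist y y' ≤ kap d ℓ * (geoP i).dist y y' :=
  distR2_le_distR0_le_mul i.D hℓ i.hMh (le_trans (by omega) i.hR) i.hP y y'

end ConverseCensus

end

end Literature.MathematicalPhysics.QuantumFieldTheory.Balaban1983to89.B6Prop22KLevelCensusR0
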